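import Literature.MathematicalPhysics.QuantumLattice.FermionBoxProductMarginals
import Literature.MathematicalPhysics.QuantumLattice.LocalUnitaryDressedSlaterBound
import HarnessLib

/-!
# One layer of disjoint gates: the dressing unitary `W = Π_g Γ_{ψ_g}(u_g)`, particle-number conservation, and the
# LIGHT CONE `Wᴴ X W = W_Tᴴ X W_T` for an observable met only by the gates in `T`

Topic `Literature/MathematicalPhysics/QuantumLattice` (namespace = path; family `hubbard`, model-free). Sequel of
`FermionBoxProductMarginals.lean`: there `boxProd φ hφ a ha S = Π_{k∈S} Γ_{φ_k}(a_k)` is the commuting product of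
`Θ`-even operators placed on boxes `φ_k : Λ₀ k ↪ Λ` with pairwise disjoint images. Read with GATES instead of box
states (a finite family of even UNITARIES `u_g` on pairwise disjoint supports — one layer of a fermionic quantum
circuit, e.g. the seam gates of the seam-dressed cluster trial states of the `T > 0` Hubbard certificate C3) the same
object is the dressing unitary `W`, and this file records its algebra:

* §1 `conjTranspose_boxProd`, `boxProd_mul_boxProd`, `boxProd_one_family`, `conjTranspose_boxProd_mul_self`
  (`Wᴴ W = 𝟙`), `boxProd_mem_unitaryGroup`; `fermionEmbed_boxProd` (`Γ_ω` of a product placed inside a window is the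
  product placed by the composed legs); `boxProd_union`; `commute_boxProd_of_mem_carSubalgebra` (graded locality).
* §2 **the light cone** `conjTranspose_boxProd_univ_mul_mul_eq` — if the observable `X ∈ 𝔄(D)` is met only by the
  gates in `T` (`D` disjoint from the supports of the other gates) then `Wᴴ X W = W_Tᴴ X W_T`, `W_T = Π_{g∈T} Γ u_g`
  [cite: BratteliRobinsonII1997, §5.2.2] (graded commutativity; this is the finite-depth-circuit light cone used
  throughout quantum information, here depth one); and its LOCAL FORM `conjTranspose_boxProd_mul_fermionEmbed_mul_eq`:
  when the gates of `T` and the observable are placed inside a window `ω : Ω ↪ Λ`, `W_Tᴴ Γ_{ι'≫ω}(x) W_T = Γ_ω(W'ᴴ Γ_{ι'} x W')`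
  with the window-level product `W'` — an explicit finite matrix on the window.
* §3 particle number: `parityAut_eq_self_of_commute_totalNumber` (number-conserving ⇒ even),
  `commute_totalNumber_boxProd` (`[W, N] = 0` when every gate conserves the particle number of its support).

Everything is PROVED; no definition, no named fact.

## Tree / Mathlib search

REUSED: `boxProd` (+ `_insert`, `_empty`, `_mem_carEvenSubalgebra`, `pairwise_commute_fermionEmbed_box`,
`commute_fermionEmbed_box_of_parityAut_eq`) (`FermionBoxProductMarginals`); `commute_of_mem_carEvenSubalgebra`,
`fermionEmbed_mem_carSubalgebra`, `disjoint_orbs`, `parityAut_conjTranspose`, `fermionEmbed_conjTranspose`,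
`fermionEmbed_fermionEmbed`; `commute_totalNumberOp_fermionEmbed`, `totalNumberOp_eq_totalNumber`,
`totalNumber_eq_diagonal_card` (`LocalUnitaryDressedSlaterBound`, `FermionOperators`, `HubbardAtomicLimit`); Mathlib
`Finset.noncommProd_union_of_disjoint`, `Finset.map_noncommProd`, `Finset.noncommProd_commute`. The same-shape,
two-cell light cone for PURE dressed Slater states is `DressedCluster.dressing_conj_cell/link`
(`DressedClusterEnergyBound.lean`); here shapes are arbitrary and the statement is operator-level.

## References

* O. Bratteli, D. W. Robinson, *Operator Algebras and Quantum Statistical Mechanics 2* (1997), §5.2.2 (graded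
  commutativity of local CAR algebras; Bogoliubov/inner automorphisms). [cite: BratteliRobinsonII1997, §5.2.2]
* H. Araki, H. Moriya, Rev. Math. Phys. 15 (2003) 93, §4.1. [cite: ArakiMoriya2003, §4.1]
-/

noncomputable section

namespace Literature.MathematicalPhysics.QuantumLattice

open Matrix Finset HubbardWave0
open scoped ComplexOrder BigOperators

/-! ### §1. Algebra of the gate layer `W = Π_g Γ_{ψ_g}(u_g)` -/

section Algebra

variable {Λ : Type*} [LinearOrder Λ] [Fintype Λ] {K : Type*}
  {Λ₀ : K → Type*} [∀ k, LinearOrder (Λ₀ k)] [∀ k, Fintype (Λ₀ k)]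
  {φ : ∀ k, Λ₀ k ↪ Λ}
  (hφ : ∀ k j, k ≠ j → Disjoint ((Finset.univ : Finset (Λ₀ k)).map (φ k)) ((Finset.univ : Finset (Λ₀ j)).map (φ j)))
  {a b : ∀ k, Matrix (Finset (Orb (Λ₀ k))) (Finset (Orb (Λ₀ k))) ℂ}
include hφ

omit hφ in
/-- Adjoints of even operators are even. [cite: ArakiMoriya2003, §4.1] -/
theorem parityAut_conjTranspose_family (ha : ∀ k, parityAut (a k) = a k) : ∀ k, parityAut (a k)ᴴ = (a k)ᴴ :=
  fun k => by rw [parityAut_conjTranspose, ha k]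

omit hφ in
/-- Products of even operators are even. [cite: ArakiMoriya2003, §4.1] -/
theorem parityAut_mul_family (ha : ∀ k, parityAut (a k) = a k) (hb : ∀ k, parityAut (b k) = b k) :
    ∀ k, parityAut (a k * b k) = a k * b k :=
  fun k => by rw [map_mul, ha k, hb k]

variable (ha : ∀ k, parityAut (a k) = a k) (hb : ∀ k, parityAut (b k) = b k)
include ha

variable [DecidableEq K]

/-- **`(Π_{k∈S} Γ a_k)ᴴ = Π_{k∈S} Γ a_kᴴ`** (the factors commute, so the order reversal is immaterial).
[cite: BratteliRobinsonII1997, §5.2.2] -/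
theorem conjTranspose_boxProd (S : Finset K) :
    (boxProd hφ a ha S)ᴴ = boxProd hφ (fun k => (a k)ᴴ) (parityAut_conjTranspose_family ha) S := by
  induction S using Finset.induction_on with
  | empty => rw [boxProd_empty, boxProd_empty, Matrix.conjTranspose_one]
  | insert k S hk ih =>
    rw [boxProd_insert hφ ha hk, boxProd_insert hφ _ hk, Matrix.conjTranspose_mul, ih, ← fermionEmbed_conjTranspose]
    refine (Finset.noncommProd_commute _ _ _ _ fun j hj => ?_).eq.symm
    exact commute_fermionEmbed_box_of_parityAut_eq hφ (ne_of_mem_of_not_mem hj hk).symm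
      (parityAut_conjTranspose_family ha k) _

/-- **`Π_S Γ a_k · Π_S Γ b_k = Π_S Γ (a_k b_k)`**. [cite: BratteliRobinsonII1997, §5.2.2] -/
theorem boxProd_mul_boxProd (S : Finset K) :
    boxProd hφ a ha S * boxProd hφ b hb S = boxProd hφ (fun k => a k * b k) (parityAut_mul_family ha hb) S := by
  induction S using Finset.induction_on with
  | empty => rw [boxProd_empty, boxProd_empty, boxProd_empty, Matrix.mul_one]
  | insert k S hk ih =>
    rw [boxProd_insert hφ ha hk, boxProd_insert hφ hb hk, boxProd_insert hφ _ hk, map_mul, ← ih]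
    have hc : Commute (boxProd hφ a ha S) (fermionEmbed (φ k) (b k)) :=
      (Finset.noncommProd_commute _ _ _ _ fun j hj =>
        commute_fermionEmbed_box_of_parityAut_eq hφ (ne_of_mem_of_not_mem hj hk).symm (hb k) _).symm
    rw [Matrix.mul_assoc, ← Matrix.mul_assoc (boxProd hφ a ha S), hc.eq]
    simp only [Matrix.mul_assoc]

omit ha in
/-- The box product of identities is the identity. [folklore] -/
private theorem boxProd_one_family (h1 : ∀ k : K, parityAut (1 : Matrix (Finset (Orb (Λ₀ k))) (Finset (Orb (Λ₀ k))) ℂ) = 1)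
    (S : Finset K) : boxProd hφ (fun _ => 1) h1 S = 1 := by
  induction S using Finset.induction_on with
  | empty => rw [boxProd_empty]
  | insert k S hk ih => rw [boxProd_insert hφ h1 hk, ih, map_one, Matrix.mul_one]

/-- **`Wᴴ W = 𝟙`**: the layer of gates is unitary when every gate is. [cite: BratteliRobinsonII1997, §5.2.2] -/
theorem conjTranspose_boxProd_mul_self (hu : ∀ k, (a k)ᴴ * a k = 1) (S : Finset K) :
    (boxProd hφ a ha S)ᴴ * boxProd hφ a ha S = 1 := by
  rw [conjTranspose_boxProd hφ ha, boxProd_mul_boxProd hφ]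
  have h1 : ∀ k : K, parityAut (1 : Matrix (Finset (Orb (Λ₀ k))) (Finset (Orb (Λ₀ k))) ℂ) = 1 := fun _ => map_one _
  have := boxProd_one_family hφ h1 S
  convert this using 2
  funext k
  exact hu k

/-- **`W Wᴴ = 𝟙`** likewise. [cite: BratteliRobinsonII1997, §5.2.2] -/
theorem boxProd_mul_conjTranspose_self (hu : ∀ k, a k * (a k)ᴴ = 1) (S : Finset K) :
    boxProd hφ a ha S * (boxProd hφ a ha S)ᴴ = 1 := by
  rw [conjTranspose_boxProd hφ ha, boxProd_mul_boxProd hφ]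
  have h1 : ∀ k : K, parityAut (1 : Matrix (Finset (Orb (Λ₀ k))) (Finset (Orb (Λ₀ k))) ℂ) = 1 := fun _ => map_one _
  have := boxProd_one_family hφ h1 S
  convert this using 2
  funext k
  exact hu k

/-- The layer of unitary gates lies in the unitary group. [cite: BratteliRobinsonII1997, §5.2.2] -/
theorem boxProd_mem_unitaryGroup (hu : ∀ k, (a k)ᴴ * a k = 1) (S : Finset K) :
    boxProd hφ a ha S ∈ Matrix.unitaryGroup (Finset (Orb Λ)) ℂ := by
  have hu' : ∀ k, a k * (a k)ᴴ = 1 := fun k => mul_eq_one_comm.1 (hu k)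
  exact Matrix.mem_unitaryGroup_iff'.2 (by
    rw [Matrix.star_eq_conjTranspose]; exact conjTranspose_boxProd_mul_self hφ ha hu S)

/-- **Splitting the layer**: `Π_{S ∪ T} = Π_S · Π_T` for disjoint index sets (products over disjoint regions).
[cite: ArakiMoriya2003, §4.1 eq. (4.16)] -/
theorem boxProd_union {S T : Finset K} (hST : Disjoint S T) :
    boxProd hφ a ha (S ∪ T) = boxProd hφ a ha S * boxProd hφ a ha T :=
  Finset.noncommProd_union_of_disjoint hST _ _

omit [DecidableEq K] in
/-- **Graded locality**: the product over `S` commutes with every observable localised away from the boxes of `S`.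
[cite: BratteliRobinsonII1997, §5.2.2] -/
theorem commute_boxProd_of_mem_carSubalgebra (S : Finset K) {D : Finset (Orb Λ)}
    {X : Matrix (Finset (Orb Λ)) (Finset (Orb Λ)) ℂ} (hX : X ∈ carSubalgebra D)
    (hD : ∀ k ∈ S, Disjoint (boxOrbs φ k) D) : Commute (boxProd hφ a ha S) X :=
  commute_of_mem_carEvenSubalgebra (boxProd_mem_carEvenSubalgebra hφ ha S) hX
    ((Finset.disjoint_biUnion_left _ _ _).2 hD)

omit [DecidableEq K] in
/-- **Placing a product inside a window**: `Γ_ω (Π_S Γ_{ψ_k} a_k) = Π_S Γ_{ψ_k ≫ ω} a_k` for legs `ψ_k` into a window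
`Ω` and a window embedding `ω : Ω ↪ Λ'`. [cite: ArakiMoriya2003, §4.1 Def. 4.3] -/
theorem fermionEmbed_boxProd {Λ' : Type*} [LinearOrder Λ'] [Fintype Λ'] (ω : Λ ↪ Λ') (S : Finset K) :
    fermionEmbed ω (boxProd hφ a ha S) =
      boxProd (φ := fun k => (φ k).trans ω)
        (fun k j hkj => by
          rw [← Finset.map_map, ← Finset.map_map]
          exact (Finset.disjoint_map ω).2 (hφ k j hkj))
        a ha S := by
  rw [boxProd, boxProd, Finset.map_noncommProd]
  refine Finset.noncommProd_congr rfl (fun k _ => ?_) _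
  rw [fermionEmbed_fermionEmbed]

/-! ### §2. The light cone -/

/-- **Light cone of one layer of gates.** If the observable `X ∈ 𝔄(D)` is met only by the gates in `T`
(`D` is disjoint from the orbitals of every gate outside `T`) and the gates are unitary, then
`Wᴴ X W = W_Tᴴ X W_T` with `W = Π_{all} Γ u_g`, `W_T = Π_{g∈T} Γ u_g`. [cite: BratteliRobinsonII1997, §5.2.2] -/
theorem conjTranspose_boxProd_univ_mul_mul_eq [Fintype K] (hu : ∀ k, (a k)ᴴ * a k = 1) (T : Finset K)
    {D : Finset (Orb Λ)} {X : Matrix (Finset (Orb Λ)) (Finset (Orb Λ)) ℂ} (hX : X ∈ carSubalgebra D)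
    (hD : ∀ k ∉ T, Disjoint (boxOrbs φ k) D) :
    (boxProd hφ a ha Finset.univ)ᴴ * X * boxProd hφ a ha Finset.univ =
      (boxProd hφ a ha T)ᴴ * X * boxProd hφ a ha T := by
  have hsplit : boxProd hφ a ha Finset.univ = boxProd hφ a ha T * boxProd hφ a ha Tᶜ := by
    rw [← boxProd_union hφ ha disjoint_compl_right]
    exact Finset.noncommProd_congr (Finset.union_compl T).symm (fun _ _ => rfl) _
  set P := boxProd hφ a ha Tᶜ
  -- `P` commutes with `X` and with `W_T`, `W_Tᴴ`
  have hPX : Commute P X :=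
    commute_boxProd_of_mem_carSubalgebra hφ ha Tᶜ hX fun k hk => hD k (Finset.mem_compl.1 hk)
  have hPT : Commute P (boxProd hφ a ha T) :=
    commute_boxProd_of_mem_carSubalgebra hφ ha Tᶜ (boxProd_mem_carSubalgebra hφ ha T) fun k hk =>
      disjoint_boxOrbs_biUnion' hφ k T (Finset.mem_compl.1 hk)
  have hPT' : Commute P (boxProd hφ a ha T)ᴴ := by
    rw [conjTranspose_boxProd hφ ha]
    exact commute_boxProd_of_mem_carSubalgebra hφ ha Tᶜ (boxProd_mem_carSubalgebra hφ _ T) fun k hk =>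
      disjoint_boxOrbs_biUnion' hφ k T (Finset.mem_compl.1 hk)
  have hPP : Pᴴ * P = 1 := conjTranspose_boxProd_mul_self hφ ha hu Tᶜ
  rw [hsplit, Matrix.conjTranspose_mul]
  calc Pᴴ * (boxProd hφ a ha T)ᴴ * X * (boxProd hφ a ha T * P)
      = Pᴴ * ((boxProd hφ a ha T)ᴴ * X * boxProd hφ a ha T * P) := by simp only [Matrix.mul_assoc]
    _ = Pᴴ * (P * ((boxProd hφ a ha T)ᴴ * X * boxProd hφ a ha T)) := by
        rw [((hPT'.mul_right hPX).mul_right hPT).eq]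
    _ = (boxProd hφ a ha T)ᴴ * X * boxProd hφ a ha T := by rw [← Matrix.mul_assoc, hPP, Matrix.one_mul]
where
  /-- the orbitals of a box outside `T` avoid those of `T` -/
  disjoint_boxOrbs_biUnion' (hφ' : ∀ k j, k ≠ j →
      Disjoint ((Finset.univ : Finset (Λ₀ k)).map (φ k)) ((Finset.univ : Finset (Λ₀ j)).map (φ j)))
      (k : K) (T : Finset K) (hk : k ∉ T) : Disjoint (boxOrbs φ k) (T.biUnion (boxOrbs φ)) :=
    (Finset.disjoint_biUnion_right _ _ _).2 fun j hj => disjoint_orbs (hφ' k j fun h => hk (h ▸ hj))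

omit [DecidableEq K] in
/-- **Local form of the light cone.** Gates `k ∈ T` placed inside a window `ω : Ω ↪ Λ` by legs `ψ_k` with
`φ_k = ψ_k ≫ ω`, observable `Γ_{ι' ≫ ω}(x)` placed inside the same window: then
`W_Tᴴ · Γ_{ι'≫ω}(x) · W_T = Γ_ω (W'ᴴ · Γ_{ι'}(x) · W')` with the WINDOW-LEVEL product `W' = Π_{k∈T} Γ_{ψ_k} u_k` — an
explicit matrix on the Fock space of the window. [cite: BratteliRobinsonII1997, §5.2.2] -/
theorem conjTranspose_boxProd_mul_fermionEmbed_mul_eq {Ω : Type*} [LinearOrder Ω] [Fintype Ω] (ω : Ω ↪ Λ)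
    {ψ : ∀ k, Λ₀ k ↪ Ω}
    (hψ : ∀ k j, k ≠ j → Disjoint ((Finset.univ : Finset (Λ₀ k)).map (ψ k)) ((Finset.univ : Finset (Λ₀ j)).map (ψ j)))
    (T : Finset K) (hcompat : ∀ k ∈ T, ∀ y, φ k y = ω (ψ k y))
    {Ω₀ : Type*} [LinearOrder Ω₀] [Fintype Ω₀] (ι' : Ω₀ ↪ Ω) (x : Matrix (Finset (Orb Ω₀)) (Finset (Orb Ω₀)) ℂ) :
    (boxProd hφ a ha T)ᴴ * fermionEmbed (ι'.trans ω) x * boxProd hφ a ha T =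
      fermionEmbed ω ((boxProd hψ a ha T)ᴴ * fermionEmbed ι' x * boxProd hψ a ha T) := by
  have hT : boxProd hφ a ha T = fermionEmbed ω (boxProd hψ a ha T) := by
    rw [fermionEmbed_boxProd hψ ha ω T, boxProd, boxProd]
    refine Finset.noncommProd_congr rfl (fun k hk => ?_) _
    exact congrFun (congrArg DFunLike.coe (fermionEmbed_congr (hcompat k hk))) (a k)
  rw [hT, map_mul, map_mul, fermionEmbed_conjTranspose, fermionEmbed_fermionEmbed]

end Algebra

/-! ### §3. Particle number -/

section Number

variable {Λ : Type*} [LinearOrder Λ] [Fintype Λ]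

/-- **A particle-number conserving operator is `Θ`-even** (`[N, X] = 0 ⇒ Θ X = X`): its entries connect only
configurations with the same particle number, on which `(−1)^N ⊗ (−1)^N = 1`. [cite: ArakiMoriya2003, §4.1 Def. 4.2] -/
theorem parityAut_eq_self_of_commute_totalNumber {X : Matrix (Finset (Orb Λ)) (Finset (Orb Λ)) ℂ}
    (hX : Commute totalNumber X) : parityAut X = X := by
  ext s s'
  rw [parityAut_apply, parityOp, Matrix.mul_diagonal, Matrix.diagonal_mul]
  by_cases h : X s s' = 0
  · rw [h, mul_zero, zero_mul]
  · have hc := congrFun (congrFun hX.eq s) s'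
    rw [totalNumber_eq_diagonal_card, Matrix.diagonal_mul, Matrix.mul_diagonal] at hc
    have hcard : (s.card : ℂ) = s'.card := by
      have : ((s.card : ℂ) - s'.card) * X s s' = 0 := by rw [sub_mul, hc, mul_comm, sub_self]
      exact sub_eq_zero.1 ((mul_eq_zero.1 this).resolve_right h)
    have hcard' : s.card = s'.card := by exact_mod_cast hcard
    rw [hcard', mul_comm ((-1 : ℂ) ^ _) (X s s'), mul_assoc, ← pow_add, ← two_mul, pow_mul, neg_one_sq, one_pow,
      mul_one]

variable {K : Type*} {Λ₀ : K → Type*} [∀ k, LinearOrder (Λ₀ k)] [∀ k, Fintype (Λ₀ k)] {φ : ∀ k, Λ₀ k ↪ Λ}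
  (hφ : ∀ k j, k ≠ j → Disjoint ((Finset.univ : Finset (Λ₀ k)).map (φ k)) ((Finset.univ : Finset (Λ₀ j)).map (φ j)))
  {a : ∀ k, Matrix (Finset (Orb (Λ₀ k))) (Finset (Orb (Λ₀ k))) ℂ}
include hφ

omit hφ in
/-- Number-conserving box operators are even (family form). [cite: ArakiMoriya2003, §4.1 Def. 4.2] -/
theorem parityAut_family_of_commute_totalNumber (haN : ∀ k, Commute totalNumber (a k)) :
    ∀ k, parityAut (a k) = a k := fun k => parityAut_eq_self_of_commute_totalNumber (haN k)

/-- **`[N, W] = 0`**: a product of number-conserving box operators conserves the particle number of `Λ`.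
[cite: BratteliRobinsonII1997, §5.2.2] -/
theorem commute_totalNumber_boxProd (haN : ∀ k, Commute totalNumber (a k)) (S : Finset K) :
    Commute totalNumber (boxProd hφ a (parityAut_family_of_commute_totalNumber haN) S) := by
  refine Finset.noncommProd_commute _ _ _ _ fun k _ => ?_
  have h := commute_totalNumberOp_fermionEmbed (φ k) (u := a k) (by rw [totalNumberOp_eq_totalNumber]; exact haN k)
  rwa [totalNumberOp_eq_totalNumber] at h

end Number

end Literature.MathematicalPhysics.QuantumLattice

end
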